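import Literature.Computability.QuantumComplexity.CWrapLayout
import Literature.Computability.QuantumComplexity.RevCleanPoly
import Literature.Computability.QuantumComplexity.RevUncomputeUniform
import Literature.Computability.Cryptography.QuantumCircuitDescFP
import Literature.Computability.Complexity.FoldBricks
import HarnessLib

/-!
# Classical wrapping inside quantum search, V: the wrapped post-processor is polynomial time

Trunk `CryptoQuantFine`; fifth file of the construction discharging
`Literature.Computability.Cryptography.isQSolvable_classicalWrap` (plan in `CWrapLayout.lean`):
**`gWrap g ∈ FP`** for `g ∈ FP` and a uniform family (`gWrap_mem_FP`), written in the brick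
algebra — reverse the input and unpair (`reverse_mem_FP`; the suffix `vg n` makes the reversed
content the pairing `⟨1ⁿ, reversed data⟩`), evaluate the layout sizes in unary on `1ⁿ`
(`Plumb.polyFn` on the polynomials `LhPoly`, `widthHPoly`, `PwPoly`, `baseBPoly`), cut out the
input and the flags (`takeFn`, `dropFn`), read the live length `ℓ*` off the one-hot flags by a
counted fold with a latch (`liveLenFn`, `FoldBricks.lean`), obtain `1^{F.ancillas ℓ*}` from the
description function of the family (`QCircuitFamily.descFn ∈ FP`, `QuantumCircuitDescFP.lean`),
compute the offset `baseB + ℓ*·Pw` in binary and back in unary (`binToUnaryFn`, capped by the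
input — harmless since the data is a part of the input), cut out the live block and apply `g` to
the pairing. The construction is exact on *every* input (the brick function *is* `gWrap g`).
(Bernstein–Vazirani 1997, §8; Arora–Barak 2009, §1.3.)

## References

* E. Bernstein, U. Vazirani, *Quantum complexity theory*, SIAM J. Comput. 26 (1997), §8.
* S. Arora, B. Barak, *Computational Complexity: A Modern Approach*, CUP 2009, §1.3.
-/

noncomputable section

namespace Literature.Computability.QuantumComplexity

namespace CWrap

open _root_.Computability Polynomial Complexity Complexity.Brick Plumb RevSim RevClean Cryptography

/-! ### The live length as a brick: the number of leading `0`s before the first `1` -/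

/-- The fold operation of the latch: accumulator `⟨l, 1ᵏ⟩` (`l = []` running, `[1]` latched),
piece = the next bit (`[b]`, or `[]` past the end): while running, a `1` latches and a `0`
counts. [folklore] -/
def latchOp : List Bool → List Bool :=
  iteFn (isNilFn ∘ fstF ∘ fstF)
    (iteFn (notFn (parityFn ∘ sndF)) (fanoutFn (fun _ => [true]) (sndF ∘ fstF))
      (fanoutFn (fun _ => []) (List.cons true ∘ sndF ∘ fstF)))
    fstF

/-- `latchOp ∈ FP`. [folklore] -/
theorem latchOp_mem_FP : latchOp ∈ FP :=
  iteFn_mem_FP (comp_mem_FP isNilFn_mem_FP (comp_mem_FP fstF_mem_FP fstF_mem_FP))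
    (iteFn_mem_FP (notFn_mem_FP (comp_mem_FP parityFn_mem_FP sndF_mem_FP))
      (fanoutFn_mem_FP (const_mem_FP _) (comp_mem_FP sndF_mem_FP fstF_mem_FP))
      (fanoutFn_mem_FP (const_mem_FP _) (comp_mem_FP (cons_mem_FP true) (comp_mem_FP sndF_mem_FP fstF_mem_FP))))
    fstF_mem_FP

/-- `latchOp`, running, on a `1`: latch. [folklore] -/
theorem latchOp_run_true (c : List Bool) : latchOp (boolPair (boolPair [] c) [true]) = boolPair [true] c := by
  rw [latchOp, iteFn_apply_true (by simp [isNilFn]), iteFn_apply_true (notFn_apply (b := false) (by simp [parityFn]))]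
  simp [fanoutFn_apply]

/-- `latchOp`, running, on a `0` or past the end: count. [folklore] -/
theorem latchOp_run_false (c p : List Bool) (hp : p = [false] ∨ p = []) :
    latchOp (boolPair (boolPair [] c) p) = boolPair [] (true :: c) := by
  have hpar : (parityFn ∘ sndF) (boolPair (boolPair [] c) p) = [true] := by
    rcases hp with rfl | rfl <;> simp [parityFn]
  rw [latchOp, iteFn_apply_true (by simp [isNilFn]), iteFn_apply_false (notFn_apply hpar)]
  simp [fanoutFn_apply]

/-- `latchOp`, latched: keep. [folklore] -/
theorem latchOp_latched (c p : List Bool) : latchOp (boolPair (boolPair [true] c) p) = boolPair [true] c := by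
  rw [latchOp, iteFn_apply_false (by simp [isNilFn])]
  simp

/-- Growth of `latchOp`: additive (`+ 4`), on every input. [folklore] -/
theorem length_latchOp_le (w : List Bool) : (latchOp w).length ≤ (fstF w).length + (sndF w).length + 4 := by
  have h0 := length_fstF_sndF_le (fstF w)
  rw [latchOp, iteFn_of_oneBit ((oneBit_isNilFn.comp _))]
  split_ifs with h1
  · rw [iteFn_of_oneBit (oneBit_notFn (oneBit_parityFn.comp _))]
    split_ifs
    · rw [length_fanoutFn]; simp only [List.length_singleton, Function.comp_apply]; omega
    · rw [length_fanoutFn]; simp only [List.length_nil, Function.comp_apply, List.length_cons]; omega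
  · omega

/-- The piece of the live-length fold: bit `i` of the flag string `x` (`⟨x, 1ⁱ⟩ ↦ (x.drop i).take 1`).
[folklore] -/
def bitPiece : List Bool → List Bool := bitAtFn ∘ fanoutFn sndF fstF

/-- Value of `bitPiece`. [folklore] -/
@[simp] theorem bitPiece_apply (x u : List Bool) : bitPiece (boolPair x u) = (x.drop u.length).take 1 := by
  simp [bitPiece, fanoutFn_apply]

/-- `bitPiece ∈ FP`. [folklore] -/
theorem bitPiece_mem_FP : bitPiece ∈ FP := comp_mem_FP bitAtFn_mem_FP (fanoutFn_mem_FP sndF_mem_FP fstF_mem_FP)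

/-- Growth of `bitPiece`: at most one symbol. [folklore] -/
theorem length_bitPiece_le (w : List Bool) : (bitPiece w).length ≤ 1 * ((fstF w).length + 1) := by
  simp only [bitPiece, Function.comp_apply, fanoutFn_apply, bitAtFn_boolPair]
  exact (List.length_take_le _ _).trans (by omega)

/-- The model of the latch after `k` bits of `fl` from index `i`: running with count, or latched.
[folklore] -/
theorem foldAcc_latch (fl : List Bool) : ∀ (k i c : ℕ),
    (∀ j, i ≤ j → j < i + k → fl.getD j false = false) →
      foldAcc latchOp bitPiece fl i k (boolPair [] (ones c)) = boolPair [] (ones (c + k)) := by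
  intro k
  induction k with
  | zero => intro i c _; simp
  | succ k ih =>
    intro i c h
    rw [foldAcc_succ, bitPiece_apply]
    have hbit : (fl.drop (ones i).length).take 1 = [false] ∨ (fl.drop (ones i).length).take 1 = [] := by
      rw [show (ones i).length = i by simp [ones]]
      by_cases hi : i < fl.length
      · left
        rw [List.take_one_drop_eq_of_lt_length hi]
        have := h i le_rfl (by omega)
        rw [List.getD_eq_getElem _ _ hi] at this
        simp [this]
      · right; simp [List.drop_eq_nil_of_le (Nat.not_lt.1 hi)]
    rw [latchOp_run_false _ _ hbit, show true :: ones c = ones (c + 1) by simp [ones, List.replicate_succ],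
      ih (i + 1) (c + 1) (fun j hj hj' => h j (by omega) (by omega))]
    congr 2; omega

/-- Once latched, the accumulator is kept. [folklore] -/
theorem foldAcc_latched (fl : List Bool) : ∀ (k i : ℕ) (c : List Bool),
    foldAcc latchOp bitPiece fl i k (boolPair [true] c) = boolPair [true] c := by
  intro k
  induction k with
  | zero => intro i c; simp
  | succ k ih => intro i c; rw [foldAcc_succ, latchOp_latched, ih]

/-- Splitting a fold into two consecutive folds. [folklore] -/
theorem foldAcc_add (op f : List Bool → List Bool) (x : List Bool) : ∀ (k₁ k₂ i : ℕ) (acc : List Bool),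
    foldAcc op f x i (k₁ + k₂) acc = foldAcc op f x (i + k₁) k₂ (foldAcc op f x i k₁ acc)
  | 0, k₂, i, acc => by simp
  | k₁ + 1, k₂, i, acc => by
    rw [show k₁ + 1 + k₂ = (k₁ + k₂) + 1 by omega, foldAcc_succ, foldAcc_add op f x k₁ k₂ (i + 1), foldAcc_succ,
      show i + 1 + k₁ = i + (k₁ + 1) by omega]

/-- **The latch fold computes the live length**: after `|fl|` bits the count is `liveLen fl`
(the position of the first `1`, `|fl|` if none), latched or not. [folklore] -/
theorem sndF_foldAcc_latch (fl : List Bool) :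
    sndF (foldAcc latchOp bitPiece fl 0 fl.length (boolPair [] [])) = ones (liveLen fl) := by
  set m := liveLen fl with hm
  have hle : m ≤ fl.length := List.findIdx_le_length
  have hbefore : ∀ j, j < m → fl.getD j false = false := by
    intro j hj
    have hjl : j < fl.length := lt_of_lt_of_le hj hle
    have h := List.not_of_lt_findIdx (p := fun b : Bool => b == true) (xs := fl) hj
    rw [List.getD_eq_getElem _ _ hjl]
    revert h
    cases fl[j] <;> simp
  -- first `m` rounds: counting
  have h1 : foldAcc latchOp bitPiece fl 0 m (boolPair [] []) = boolPair [] (ones m) := by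
    have := foldAcc_latch fl m 0 0 (fun j _ hj => hbefore j (by omega))
    simpa [ones] using this
  rcases Nat.lt_or_ge m fl.length with hlt | hge
  · -- the `1` at position `m` latches, the rest is kept
    have hm1 : fl[m] = true := by
      have h : (fl[m]'hlt == true) = true := List.findIdx_getElem (p := fun b : Bool => b == true) (xs := fl) (w := hlt)
      revert h
      cases fl[m] <;> simp
    rw [show fl.length = m + (1 + (fl.length - m - 1)) by omega, foldAcc_add, h1, Nat.zero_add, foldAcc_add,
      show foldAcc latchOp bitPiece fl m 1 (boolPair [] (ones m)) = boolPair [true] (ones m) from ?_, foldAcc_latched,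
      sndF_boolPair]
    rw [foldAcc_succ, foldAcc_zero, bitPiece_apply, show (ones m).length = m by simp [ones],
      List.take_one_drop_eq_of_lt_length hlt, List.get_eq_getElem, hm1]
    exact latchOp_run_true _
  · have heq : m = fl.length := le_antisymm hle hge
    rw [← heq, h1, sndF_boolPair]

/-- **The live-length brick**: `fl ↦ 1^{liveLen fl}` (fold the bits with the latch, `|fl|`
rounds, read the count). [cite: AroraBarak2009, §1.3 (bounded loops)] -/
def liveLenFn : List Bool → List Bool :=
  sndF ∘ sndPow 2 ∘ foldLoop latchOp bitPiece X ∘ fanoutFn (fun w => w) (fanoutFn lenBinF (fun _ => boolPair [] (boolPair [] [])))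

/-- **`liveLenFn fl = 1^{liveLen fl}`.** [folklore] -/
@[simp] theorem liveLenFn_apply (fl : List Bool) : liveLenFn fl = ones (liveLen fl) := by
  have h0 : fanoutFn (fun w => w) (fanoutFn lenBinF (fun _ => boolPair [] (boolPair [] []))) fl =
      boolPair fl (boolPair (encodeNat fl.length) (boolPair (ones 0) (boolPair [] []))) := by
    simp [fanoutFn_apply, ones]
  rw [liveLenFn, Function.comp_apply, Function.comp_apply, Function.comp_apply, h0,
    foldLoop_apply latchOp bitPiece (by simp) 0 _, sndPow_succ_boolPair, sndPow_succ_boolPair, sndPow_zero_boolPair,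
    sndF_foldAcc_latch]

/-- `liveLenFn ∈ FP`. [folklore] -/
theorem liveLenFn_mem_FP : liveLenFn ∈ FP :=
  comp_mem_FP sndF_mem_FP (comp_mem_FP (sndPow_mem_FP 2) (comp_mem_FP
    (foldLoop_mem_FP latchOp_mem_FP length_latchOp_le bitPiece_mem_FP length_bitPiece_le X)
    (fanoutFn_mem_FP (PolyTimeComputable.id _) (fanoutFn_mem_FP lenBinF_mem_FP (const_mem_FP _)))))

/-! ### The layout sizes as polynomials -/

section Polys

variable (Q : Layout)

/-- `L(n)` as a polynomial (`JJ - 1 = Sn + (dd - 1)`). [folklore] -/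
def LhPoly : Polynomial ℕ := SnPoly Q.Mh.tm Q.eh + C (dd Q.Mh.tm - 1)

/-- `widthH(n)` as a polynomial. [folklore] -/
def widthHPoly : Polynomial ℕ := widthPoly Q.eh Q.Mh

/-- `Pw(n)` as a polynomial. [folklore] -/
def PwPoly : Polynomial ℕ := LhPoly Q + Q.pF.comp (LhPoly Q)

/-- `baseB(n)` as a polynomial. [folklore] -/
def baseBPoly : Polynomial ℕ := widthHPoly Q + (LhPoly Q + 1) + PwPoly Q

variable {Q}

/-- Value of `LhPoly`. [folklore] -/
@[simp] theorem eval_LhPoly (n : ℕ) : (LhPoly Q).eval n = Lh Q n := by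
  have := one_le_dd Q.Mh.tm
  simp only [LhPoly, eval_add, eval_SnPoly, eval_C]
  unfold Lh JJ; omega

/-- Value of `widthHPoly`. [folklore] -/
@[simp] theorem eval_widthHPoly (n : ℕ) : (widthHPoly Q).eval n = widthH Q n := by
  simp [widthHPoly, widthH]

/-- Value of `PwPoly`. [folklore] -/
@[simp] theorem eval_PwPoly (n : ℕ) : (PwPoly Q).eval n = Pw Q n := by
  simp [PwPoly, Pw, eval_comp]

/-- Value of `baseBPoly`. [folklore] -/
@[simp] theorem eval_baseBPoly (n : ℕ) : (baseBPoly Q).eval n = baseB Q n := by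
  simp [baseBPoly, baseB]

end Polys

/-! ### The brick of `gWrap` -/

section Wrap

variable (Q : Layout) (g : List Bool → List Bool)

/-- From the input `u`: the reversed input `r`. Its first component is `1ⁿ`, its second the
reversed data. [folklore] -/
def nUF : List Bool → List Bool := fstF ∘ List.reverse

/-- The data `d`. [folklore] -/
def dF : List Bool → List Bool := List.reverse ∘ sndF ∘ List.reverse

/-- The input part `x = d ↾ n`. [folklore] -/
def xF : List Bool → List Bool := takeFn ∘ fanoutFn nUF dF

/-- The flags `(d ↓ widthH n) ↾ (L(n) + 1)`. [folklore] -/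
def flF : List Bool → List Bool :=
  takeFn ∘ fanoutFn (polyFn (LhPoly Q + 1) ∘ nUF) (dropFn ∘ fanoutFn (polyFn (widthHPoly Q) ∘ nUF) dF)

/-- The live length `1^{ℓ*}`. [folklore] -/
def lsF : List Bool → List Bool := liveLenFn ∘ flF Q

/-- The ancilla count `1^{F.ancillas ℓ*}`, from the description function of the family. [folklore] -/
def aF : List Bool → List Bool := fstF ∘ sndF ∘ Q.F.descFn ∘ lsF Q

/-- The offset `baseB n + ℓ* · Pw n` in unary, capped by the input length. [folklore] -/
def offF : List Bool → List Bool :=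
  binToUnaryFn ∘ fanoutFn (fun u => u)
    (addFn ∘ fanoutFn (lenBinF ∘ polyFn (baseBPoly Q) ∘ nUF)
      (prodFn ∘ fanoutFn (lenBinF ∘ lsF Q) (lenBinF ∘ polyFn (PwPoly Q) ∘ nUF)))

/-- The live block content `(d ↓ offset) ↾ (ℓ* + F.ancillas ℓ*)`. [folklore] -/
def yF : List Bool → List Bool :=
  takeFn ∘ fanoutFn (appF ∘ fanoutFn (lsF Q) (aF Q)) (dropFn ∘ fanoutFn (offF Q) dF)

/-- **The brick of the wrapped post-processor.** [cite: BernsteinVazirani1997, §8 (classical computation inside quantum machines)] -/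
def gWrapF : List Bool → List Bool := g ∘ fanoutFn xF (yF Q)

variable {Q g}

/-- `nUF u = (boolUnpair u.reverse).1`. [folklore] -/
theorem nUF_apply (u : List Bool) : nUF u = (boolUnpair u.reverse).1 := rfl

/-- `dF u = (boolUnpair u.reverse).2.reverse`. [folklore] -/
theorem dF_apply (u : List Bool) : dF u = (boolUnpair u.reverse).2.reverse := rfl

/-- The data is not longer than the input. [folklore] -/
theorem length_dF_le (u : List Bool) : (dF u).length ≤ u.length := by
  rw [dF_apply, List.length_reverse]
  have h := length_fstF_sndF_le u.reverse
  simp only [fstF, sndF, List.length_reverse] at h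
  omega

/-- The flags computed. [folklore] -/
theorem flF_apply (u : List Bool) :
    flF Q u = (((dF u).drop (widthH Q (nUF u).length)).take (Lh Q (nUF u).length + 1)) := by
  simp [flF, fanoutFn_apply, ones]

/-- The live length computed. [folklore] -/
theorem lsF_apply (u : List Bool) :
    lsF Q u = ones (liveLen (((dF u).drop (widthH Q (nUF u).length)).take (Lh Q (nUF u).length + 1))) := by
  rw [lsF, Function.comp_apply, flF_apply, liveLenFn_apply]

/-- The ancilla count computed. [folklore] -/
theorem aF_apply (u : List Bool) :
    aF Q u = unaryEncodeNat (Q.F.ancillas (liveLen (((dF u).drop (widthH Q (nUF u).length)).take (Lh Q (nUF u).length + 1)))) := by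
  rw [aF, Function.comp_apply, Function.comp_apply, Function.comp_apply, lsF_apply, QCircuitFamily.descFn_eq]
  simp [ones]

/-- The offset computed (capped by the input length). [folklore] -/
theorem offF_apply (u : List Bool) :
    offF Q u = ones (min (baseB Q (nUF u).length +
      liveLen (((dF u).drop (widthH Q (nUF u).length)).take (Lh Q (nUF u).length + 1)) * Pw Q (nUF u).length) u.length) := by
  simp [offF, fanoutFn_apply, lsF_apply, ones]

/-- Dropping a capped amount from a list not longer than the cap. [folklore] -/
theorem drop_min_of_length_le {l : List Bool} {a b : ℕ} (h : l.length ≤ b) : l.drop (min a b) = l.drop a := by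
  rcases le_total a b with hab | hab
  · rw [Nat.min_eq_left hab]
  · rw [Nat.min_eq_right hab, List.drop_eq_nil_of_le h, List.drop_eq_nil_of_le (h.trans hab)]

/-- **The brick is the wrapped post-processor, on every input.** [folklore] -/
theorem gWrapF_eq : gWrapF Q g = gWrap Q g := by
  funext u
  have hy : yF Q u = (((dF u).drop (blockW Q (nUF u).length
      (liveLen (((dF u).drop (widthH Q (nUF u).length)).take (Lh Q (nUF u).length + 1))) 0)).take
      (liveLen (((dF u).drop (widthH Q (nUF u).length)).take (Lh Q (nUF u).length + 1)) +
        Q.F.ancillas (liveLen (((dF u).drop (widthH Q (nUF u).length)).take (Lh Q (nUF u).length + 1))))) := by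
    simp only [yF, Function.comp_apply, fanoutFn_apply, takeFn_boolPair, appF_boolPair, dropFn_boolPair, lsF_apply,
      aF_apply, offF_apply, List.length_append, unaryEncodeNat_eq_replicate, List.length_replicate]
    rw [drop_min_of_length_le (length_dF_le u)]
    unfold blockW; simp
  simp only [gWrapF, gWrap, Function.comp_apply, fanoutFn_apply, xF, takeFn_boolPair, hy, nUF_apply, dF_apply]

/-- `nUF ∈ FP`. [folklore] -/
theorem nUF_mem_FP : nUF ∈ FP := comp_mem_FP fstF_mem_FP reverse_mem_FP

/-- `dF ∈ FP`. [folklore] -/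
theorem dF_mem_FP : dF ∈ FP := comp_mem_FP reverse_mem_FP (comp_mem_FP sndF_mem_FP reverse_mem_FP)

/-- `lsF ∈ FP`. [folklore] -/
theorem lsF_mem_FP : lsF Q ∈ FP :=
  comp_mem_FP liveLenFn_mem_FP (comp_mem_FP takeFn_mem_FP (fanoutFn_mem_FP (comp_mem_FP (polyFn_mem_FP _) nUF_mem_FP)
    (comp_mem_FP dropFn_mem_FP (fanoutFn_mem_FP (comp_mem_FP (polyFn_mem_FP _) nUF_mem_FP) dF_mem_FP))))

/-- **`gWrap g ∈ FP`** for `g ∈ FP` and a uniform family. [cite: BernsteinVazirani1997, §8 (classical computation inside quantum machines)] -/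
theorem gWrap_mem_FP (hg : g ∈ FP) (hU : Q.F.IsUniform) : gWrap Q g ∈ FP := by
  rw [← gWrapF_eq]
  have hdesc : Q.F.descFn ∈ FP := QCircuitFamily.descFn_mem_FP_of_isUniform hU
  have haF : aF Q ∈ FP := comp_mem_FP fstF_mem_FP (comp_mem_FP sndF_mem_FP (comp_mem_FP hdesc lsF_mem_FP))
  have hoff : offF Q ∈ FP :=
    comp_mem_FP binToUnaryFn_mem_FP (fanoutFn_mem_FP (PolyTimeComputable.id _)
      (comp_mem_FP addFn_mem_FP (fanoutFn_mem_FP (comp_mem_FP lenBinF_mem_FP (comp_mem_FP (polyFn_mem_FP _) nUF_mem_FP))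
        (comp_mem_FP prodFn_mem_FP (fanoutFn_mem_FP (comp_mem_FP lenBinF_mem_FP lsF_mem_FP)
          (comp_mem_FP lenBinF_mem_FP (comp_mem_FP (polyFn_mem_FP _) nUF_mem_FP)))))))
  have hy : yF Q ∈ FP :=
    comp_mem_FP takeFn_mem_FP (fanoutFn_mem_FP (comp_mem_FP appF_mem_FP (fanoutFn_mem_FP lsF_mem_FP haF))
      (comp_mem_FP dropFn_mem_FP (fanoutFn_mem_FP hoff dF_mem_FP)))
  exact comp_mem_FP hg (fanoutFn_mem_FP (comp_mem_FP takeFn_mem_FP (fanoutFn_mem_FP nUF_mem_FP dF_mem_FP)) hy)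

end Wrap

end CWrap

end Literature.Computability.QuantumComplexity

end
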